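import Mathlib
import HarnessLib
import Summits.Parity.Statement
import Summits.Parity.BatemanHorn.Theses.OneSidedDegreeLadder
import Literature.NumberTheory.Sieve.BatemanHornProofs
import Literature.NumberTheory.Sieve.ParityWave0
import Literature.NumberTheory.Sieve.ParityWave0BunyakovskyProofs
import Literature.NumberTheory.Sieve.HardyLittlewoodProofs
import Summits.Parity.BatemanHorn.Theorems.OneSidedDegreeLadderNormFormSlicesDefs
import Summits.Parity.BatemanHorn.Theorems.OneSidedDegreeLadderNormFormSlicesIdentity

/-!
# `OneSidedDegreeLadder` — «NormFormSliceLadder»: the Bateman–Horn face along the NUMBER-OF-VARIABLES axis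
# (hand (c): THEOREMS ONLY — necessity, exactness, the cells; decomp-parity node B1.1.5, lens-1 g8, critic row 96,
# writer DECISION 2026-08-30T12:35:37Z; CONSEQUENCE NOTCH beneath the record leaf `LowerNonlinear` stmt-Parity-25177,
# zero distance credit)

# leaf `OneSidedDegreeLadder.LowerNonlinear` = stmt-Parity-25177; T13/T21/T22-compliant: no root door, zero credit)

THE MOVE.  A monic Bateman–Horn polynomial `f` of degree `n` is the bottom AFFINE LINE of a tower of thicker
prime-value problems: with `ω` the class of `X` in `ℤ[X]/(f)` and `N = N_{ℤ[ω]/ℤ}` (Mathlib `Algebra.norm ℤ` on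
`AdjoinRoot f`),

  `f(a) = N(a − ω)`            (`norm_algebraMap_sub_root`: `det(a·1 − C_f) = χ_{C_f}(a) = f(a)`, companion matrix),

so `f(ℤ)` is the affine slice `x = (a, −1, 0, …, 0)` of the `m`-variable INCOMPLETE NORM FORM
`N(x₀ + x₁ω + ⋯ + x_{m−1}ω^{m−1})` (`sliceNorm f m`), `2 ≤ m ≤ n`, a form of degree `n` in `m` variables whose values
`≤ x` number `≍ x^{m/n}`.  The GRADE is the density `δ = m/n`: `δ = 1/n` is Bateman–Horn for `f` itself, `δ = 1` the
full norm form.  Cell `(n, m)` := «for every monic Bateman–Horn `f` of degree `n`, the `m`-slice takes infinitely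
many prime values» (`(slicePrimes f m).Infinite`); every cell with `m ≥ 2` is a NECESSARY consequence of the leaf
(hyp-free: `sliceCells_of_lowerNonlinear`), of `BatemanHorn` and of the root `Parity`.

THE LADDER (δ = m/n; status with sources — print pages verified, tree decls BY NAME):
* δ = 1 (m = n): THEOREM in print — «every degree 1 principal prime ideal of K gives a prime value of N_{K/ℚ}»
  [arXiv:1507.05080 p.3]; classical (Weber/Landau prime ideal theorem in classes).  Not typed here.
* δ ≥ 3/4 (n ≥ 4k, k := n − m), ALL monic irreducible f: THEOREM, asymptotic — Maynard, *Primes represented by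
  incomplete norm forms*, Forum Math. Pi 8 (2020) e3, Thm 1.1 [arXiv:1507.05080 p.3].
* 15/22 < δ < 3/4 (n > 22k/7; Maynard states `n ≥ 22k/7`): THEOREM, lower bound of the right order, for PURE
  fields `f = X^n − θ` only — Maynard Thm 1.2 [arXiv:1507.05080 p.3]; for general monic f: OPEN → piece
  `MaynardBandAllFields` [ATTACKABLE: the sieve side is field-independent — in Ford–Maynard's coordinates
  `P_θ = (1−θ, θ, 1−3θ)`, `θ = k/n = 1 − δ`, one has `C⁻(P_θ) = 1` for `θ ≤ 1/4`, the EXACT value of `C⁻(P_θ) > 0`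
  for `1/4 < θ ≤ 2/7` (Thm 2.6, e.g. `C⁻(5/7,2/7,1/7) = 0.92148…`) and positivity up to Maynard's `7/22`
  [arXiv:2407.14368 p.7]; what is pure-field-specific are the ALGEBRAIC Type I/II inputs].  First cells: (7,5)
  (`θ = 2/7` exactly), (10,7), (11,8), (13,9).
* 2/3 < δ ≤ 15/22 (`7/22 ≤ θ < 1/3`): generic Type-II window `ν = 1 − 3θ = 3δ − 2 ∈ (0, 1/22]`, beyond Maynard's
  positivity range and approaching the NON-EXPLICIT zone of the tree barrier
  `Literature.Barriers.Parity.FordMaynardMinimalTypeII` (PROVED in the tree: `FordMaynardMinimalTypeII_holds`;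
  Ford–Maynard Thm 2.1; p.7: «as θ → 1/3 the Type II range becomes arbitrarily small, and so … C⁻(P_θ) = 0 when θ is
  sufficiently close to 1/3. Thus the main region of interest is 1/4 < θ with θ not too close to 1/3»): SIGN OF
  `C⁻(P_θ)` UNKNOWN per cell → [INSTRUMENTABLE: extend the exact/lower-bound computations of `C⁻(P_θ)` beyond
  `θ = 3/10 … 7/22` (Ford–Maynard §2/§8); kit-grade numerics, not run here (kit_allowed = false)].  First cell:
  (25,17) (`2/3 < 17/25 < 15/22`, `dial_facts`); (22,15) sits exactly at `θ = 7/22`.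
* 1/2 < δ ≤ 2/3: the generic Type-II window is EMPTY (`ν = 3δ − 2 ≤ 0`): «If one simply bounds the naturally
  occurring error terms by their absolute values … one can only hope to obtain Type I and Type II estimates in
  certain restricted ranges depending on the density … Heath-Brown obtains an asymptotic in a sparser sequence
  precisely because he is able to treat the error terms arising in a non-trivial manner» [arXiv:1507.05080 p.4].
  The ONE theorem band-edge is δ = 2/3 at n = 3: binary cubic forms — Heath-Brown, Acta Math. 186 (2001) (`x³+2y³`;
  tree NAMED FACT parity.S18 `Literature.NumberTheory.Sieve.setOf_prime_cube_add_two_mul_cube_infinite`, discharged in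
  the tree from `HeathBrown2001_primePairCount_asymptotic`) and Heath-Brown–Moroz, Proc. LMS 84 (2002) (all
  irreducible binary cubic forms) [cited arXiv:1507.05080 p.3 as HBMorozI/II].  Every other cell of the band is OPEN
  and needs a NON-GENERIC Type-II input → pieces `TernaryQuinticSlice` (5,3) (δ = 3/5, ν = −1/5) and
  `QuaternarySexticSlice` (6,4) (δ = 2/3 = Heath-Brown's density, ν = 0: «Heath-Brown's cubic one dimension up»)
  [IDEA-NEEDED; barrier BY NAME: `FordMaynardMinimalTypeII` zone, Type I/II information alone gives `C⁻ = 0`].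
* δ ≤ 1/2: THE WALL.  Values `≤ x` number `≤ x^{1/2}`, so any Type-I level is `< x^{1/2}`: the tree barrier

BOOKING (T21 normal form, zero credit): `LowerNonlinear ⟺ SliceAll ∧ SliceLift` EXACTLY (`lowerNonlinear_iff_slices`,
hyp-free), and the lift factors through the shared BH-side floor: `SliceLift ⟺ BunyakovskyLift ∧ SliceDescent`
(`sliceLift_iff_floor`; `BunyakovskyNonlin`/`BunyakovskyLift` = the B1.1.4 «ChebyshevResultantSplit» texts VERBATIM,
cited not re-booked; `SliceDescent := SliceAll → BunyakovskyNonlin`); `SliceLift` is the DECLARED RESIDUAL, never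
staffed.  Band split (critic P1): `3n ≤ 4m` = known theorem for all `f` (rungs by name), `15n ≤ 22m ∧ 4m < 3n` =
theorem for pure `f`, attackable-literature question for general `f`; (5,3), (6,4) IDEA-NEEDED
(`FordMaynardMinimalTypeII` zone); binary slices `n ≥ 4` BARRIER-class (`FordMaynardLowLevel`); Bateman–Horn itself
sits at `δ = 1/n ≤ 1/2`, at or below the wall (`batemanHorn_grade_le_half`) — no rung of this ladder approaches the
leaf.  All Props INLINED (no `def … : Prop`); data definitions in `…NormFormSlicesDefs`, slice identities in
`…NormFormSlicesIdentity`.  No `sorry`, standard axioms.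
-/

open Filter Finset Polynomial
open scoped Topology

open Literature.NumberTheory.Sieve

namespace Summit.Parity.BatemanHorn.Theses.OneSidedDegreeLadder.NormFormSlice

noncomputable section

/-! ## §3 NECESSITY (hypothesis-free): prime values of `f` feed every slice -/

/-- Infinitely many prime values of a monic `f` (degree `≥ 1`) give infinitely many prime values of every slice
`m ≥ 2` (the values `f(n) → ∞` are unbounded, so the prime VALUES are infinite, not just the arguments). -/
theorem slicePrimes_infinite_of_primeValues {f : ℤ[X]} (hf : f.Monic) (h1 : 1 ≤ f.natDegree)
    (hinf : {n : ℕ | Prime (f.eval (n : ℤ))}.Infinite) {m : ℕ} (hm : 2 ≤ m) :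
    (slicePrimes f m).Infinite := by
  refine Set.infinite_of_forall_exists_gt fun N => ?_
  have hlc : 0 < f.leadingCoeff := by rw [hf.leadingCoeff]; exact one_pos
  obtain ⟨n₀, hn₀⟩ := eventually_atTop.mp
    ((tendsto_eval_natCast_atTop h1 hlc).eventually (eventually_gt_atTop (N : ℤ)))
  obtain ⟨n, hnS, hn⟩ := hinf.exists_gt n₀
  have hgt : (N : ℤ) < f.eval (n : ℤ) := hn₀ n hn.le
  have hpos : 0 < f.eval (n : ℤ) := lt_of_le_of_lt (by positivity) hgt
  have hcast : (((f.eval (n : ℤ)).toNat : ℕ) : ℤ) = f.eval (n : ℤ) := Int.toNat_of_nonneg hpos.le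
  refine ⟨(f.eval (n : ℤ)).toNat, ⟨?_, affinePt n, ?_⟩, ?_⟩
  · have habs : (f.eval (n : ℤ)).toNat = (f.eval (n : ℤ)).natAbs := by omega
    rw [habs]
    exact Int.prime_iff_natAbs_prime.mp hnS
  · rw [sliceNorm_affinePt hf hm, hcast]
  · exact_mod_cast (show (N : ℤ) < ((f.eval (n : ℤ)).toNat : ℕ) by rw [hcast]; exact hgt)

/-- The qualitative core of the leaf on monic polynomials feeds ALL cells: if every non-linear monic Bateman–Horn
polynomial takes infinitely many prime values, every slice `m ≥ 2` of every such polynomial does. -/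
theorem sliceCells_of_coreMonic
    (hB : ∀ f : ℤ[X], IsBatemanHornSystem ![f] → f.Monic → 2 ≤ f.natDegree →
      {n : ℕ | Prime (f.eval (n : ℤ))}.Infinite) :
    ∀ f : ℤ[X], IsBatemanHornSystem ![f] → f.Monic → 2 ≤ f.natDegree →
      ∀ m : ℕ, 2 ≤ m → (slicePrimes f m).Infinite :=
  fun f hf hmo hdeg _m hm => slicePrimes_infinite_of_primeValues hmo (by omega) (hB f hf hmo hdeg) hm

/-- The tree's `BunyakovskyConjecture` (parity.S09) gives the monic core (hypothesis translation: tree lemma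
`hasNoFixedPrimeDivisor_iff_forall_exists_not_dvd`), hence all cells. -/
theorem sliceCells_of_bunyakovsky (h : BunyakovskyConjecture) :
    ∀ f : ℤ[X], IsBatemanHornSystem ![f] → f.Monic → 2 ≤ f.natDegree →
      ∀ m : ℕ, 2 ≤ m → (slicePrimes f m).Infinite :=
  sliceCells_of_coreMonic fun f hf _ hdeg =>
    h f (by simpa using hf.irreducible 0) (by omega) (by simpa using hf.leadingCoeff_pos 0) fun p hp => by
      have := (hasNoFixedPrimeDivisor_iff_forall_exists_not_dvd _).1 hf.hasNoFixedPrimeDivisor p hp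
      simpa only [Fin.prod_univ_one, Matrix.cons_val_fin_one] using this

/-- One-polynomial bookkeeping: the count of the system `![f]`. -/
theorem polyPrimeCount_single (f : ℤ[X]) (x : ℕ) :
    polyPrimeCount ![f] x =
      ((range (x + 1)).filter fun n : ℕ => 0 < f.eval (n : ℤ) ∧ (f.eval (n : ℤ)).toNat.Prime).card := by
  unfold polyPrimeCount
  simp only [Fin.forall_fin_one, Matrix.cons_val_fin_one]

/-- The leaf makes `π_f(x) → ∞` for every non-linear Bateman–Horn `f` (leaf at `k = 1`, `ε = 1/2`; argument of
lens-2 g9 `ChebyshevResultantSplit.tendsto_count_of_lowerNonlinear`, re-derived over tree lemmas). -/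
theorem tendsto_polyPrimeCount_of_lowerNonlinear (hL : LowerNonlinear) {f : ℤ[X]}
    (hf : IsBatemanHornSystem ![f]) (hdeg : 2 ≤ f.natDegree) :
    Tendsto (fun x : ℕ => (polyPrimeCount ![f] x : ℝ)) atTop atTop := by
  have hC : 0 < batemanHornConst ![f] := (IsBatemanHornSystem.hasBatemanHornConst_holds hf).2
  have hd : (0 : ℝ) < f.natDegree := by exact_mod_cast (lt_of_lt_of_le (by norm_num) hdeg)
  have hK : 0 < batemanHornConst ![f] / (2 * (f.natDegree : ℝ)) := by positivity
  have h := hL 1 ![f] hf ⟨0, by simpa using hdeg⟩ (1 / 2) (by norm_num)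
  have hev : ∀ᶠ x : ℕ in atTop,
      batemanHornConst ![f] / (2 * (f.natDegree : ℝ)) * ((x : ℝ) / Real.log x ^ 1) ≤ (polyPrimeCount ![f] x : ℝ) := by
    filter_upwards [h] with x hx
    have hprod : (∏ i : Fin 1, (((![f] : Fin 1 → ℤ[X]) i).natDegree : ℝ)) = f.natDegree := by simp
    rw [hprod] at hx
    have : batemanHornConst ![f] / (2 * (f.natDegree : ℝ)) * ((x : ℝ) / Real.log x ^ 1)
        = (1 - 1 / 2) * (batemanHornConst ![f] / (f.natDegree : ℝ) * (x : ℝ) / Real.log x ^ 1) := by ring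
    rw [this]
    exact hx
  exact tendsto_atTop_mono' atTop hev ((tendsto_natCast_div_log_pow_atTop 1).const_mul_atTop hK)

/-- **NECESSITY OF THE CORE FROM THE LEAF** (hyp-free; lens-2 g9's `bunyakovskyNonlin_of_lowerNonlinear`, text of
`BunyakovskyNonlin` verbatim): every non-linear Bateman–Horn polynomial takes infinitely many prime values. -/
theorem core_of_lowerNonlinear (hL : LowerNonlinear) :
    ∀ f : ℤ[X], IsBatemanHornSystem ![f] → 2 ≤ f.natDegree → {n : ℕ | Prime (f.eval (n : ℤ))}.Infinite := by
  intro f hf hdeg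
  have hlim := tendsto_polyPrimeCount_of_lowerNonlinear hL hf hdeg
  by_contra hfin
  rw [Set.not_infinite] at hfin
  have hbound : ∀ x, (polyPrimeCount ![f] x : ℝ) ≤ hfin.toFinset.card := by
    intro x
    rw [polyPrimeCount_single]
    exact_mod_cast Finset.card_le_card fun n hn => by
      rw [Finset.mem_filter] at hn
      obtain ⟨hpos, hpr⟩ := hn.2
      rw [Set.Finite.mem_toFinset, Set.mem_setOf_eq]
      have h1 := Nat.prime_iff_prime_int.1 hpr
      rwa [Int.toNat_of_nonneg hpos.le] at h1
  obtain ⟨x, hx⟩ := (hlim.eventually_gt_atTop (hfin.toFinset.card : ℝ)).exists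
  exact absurd (hbound x) (not_le.mpr hx)

/-- **NECESSITY FROM THE LEAF** (hyp-free): `LowerNonlinear` ⟹ every cell `(n, m)`, `m ≥ 2`. -/
theorem sliceCells_of_lowerNonlinear (hL : LowerNonlinear) :
    ∀ f : ℤ[X], IsBatemanHornSystem ![f] → f.Monic → 2 ≤ f.natDegree →
      ∀ m : ℕ, 2 ≤ m → (slicePrimes f m).Infinite :=
  sliceCells_of_coreMonic fun f hf _ hdeg => core_of_lowerNonlinear hL f hf hdeg

/-- NECESSITY FROM THE CONJUNCT `BatemanHorn` (tree theorem `bunyakovskyConjecture_of_batemanHornConjecture`). -/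
theorem sliceCells_of_batemanHorn (h : BatemanHorn) :
    ∀ f : ℤ[X], IsBatemanHornSystem ![f] → f.Monic → 2 ≤ f.natDegree →
      ∀ m : ℕ, 2 ≤ m → (slicePrimes f m).Infinite :=
  sliceCells_of_bunyakovsky (bunyakovskyConjecture_of_batemanHornConjecture h)

/-- NECESSITY FROM THE ROOT `Parity`. -/
theorem sliceCells_of_parity (h : Parity) :
    ∀ f : ℤ[X], IsBatemanHornSystem ![f] → f.Monic → 2 ≤ f.natDegree →
      ∀ m : ℕ, 2 ≤ m → (slicePrimes f m).Infinite :=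
  sliceCells_of_batemanHorn h.1

/-! ## §4 EXACTNESS and the T21 floor (zero credit) -/

/-- **EXACTNESS (hyp-free):** `LowerNonlinear ⟺ SliceAll ∧ SliceLift`, with `SliceAll` = all cells `m ≥ 2` of all
non-linear monic Bateman–Horn polynomials and `SliceLift := SliceAll → LowerNonlinear` the declared residual. -/
theorem lowerNonlinear_iff_slices :
    LowerNonlinear ↔
      (∀ f : ℤ[X], IsBatemanHornSystem ![f] → f.Monic → 2 ≤ f.natDegree →
        ∀ m : ℕ, 2 ≤ m → (slicePrimes f m).Infinite) ∧
      ((∀ f : ℤ[X], IsBatemanHornSystem ![f] → f.Monic → 2 ≤ f.natDegree →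
        ∀ m : ℕ, 2 ≤ m → (slicePrimes f m).Infinite) → LowerNonlinear) :=
  ⟨fun h => ⟨sliceCells_of_lowerNonlinear h, fun _ => h⟩, fun ⟨hA, hL⟩ => hL hA⟩

/-- **T21 NORMAL FORM of the residual:** `SliceLift ⟺ BunyakovskyLift ∧ SliceDescent`, where
`BunyakovskyLift := BunyakovskyNonlin → LowerNonlinear` is the shared BH-side floor of lens-2 g9 (texts verbatim)
and `SliceDescent := SliceAll → BunyakovskyNonlin` («from prime values of the thick slices down to the affine line»)
is this notch's own qualitative factor.  Parity-loaded; never credited. -/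
theorem sliceLift_iff_floor :
    ((∀ f : ℤ[X], IsBatemanHornSystem ![f] → f.Monic → 2 ≤ f.natDegree →
        ∀ m : ℕ, 2 ≤ m → (slicePrimes f m).Infinite) → LowerNonlinear) ↔
      (((∀ f : ℤ[X], IsBatemanHornSystem ![f] → 2 ≤ f.natDegree → {n : ℕ | Prime (f.eval (n : ℤ))}.Infinite) →
          LowerNonlinear) ∧
        ((∀ f : ℤ[X], IsBatemanHornSystem ![f] → f.Monic → 2 ≤ f.natDegree →
            ∀ m : ℕ, 2 ≤ m → (slicePrimes f m).Infinite) →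
          ∀ f : ℤ[X], IsBatemanHornSystem ![f] → 2 ≤ f.natDegree → {n : ℕ | Prime (f.eval (n : ℤ))}.Infinite)) :=
  ⟨fun h => ⟨fun hB => h (sliceCells_of_coreMonic fun f hf _ hdeg => hB f hf hdeg),
      fun hA => core_of_lowerNonlinear (h hA)⟩,
    fun ⟨hL, hD⟩ hA => hL (hD hA)⟩

/-! ## §5 THE PIECES (cells of the ladder; each necessary, hyp-free) -/

/-- **Piece `TernaryQuinticSlice`** = cell (5,3), δ = 3/5: for every monic Bateman–Horn quintic `f`,
`N(x + yω + zω²)` takes infinitely many prime values.  [IDEA-NEEDED: generic Type-II window `3δ − 2 = −1/5 < 0`;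
zone of `Literature.Barriers.Parity.FordMaynardMinimalTypeII` BY NAME.]  Necessary: -/
theorem ternaryQuinticSlice_of_lowerNonlinear (hL : LowerNonlinear) :
    ∀ f : ℤ[X], IsBatemanHornSystem ![f] → f.Monic → f.natDegree = 5 → (slicePrimes f 3).Infinite :=
  fun f hf hmo hdeg => sliceCells_of_lowerNonlinear hL f hf hmo (by omega) 3 (by norm_num)

/-- **Piece `QuaternarySexticSlice`** = cell (6,4), δ = 2/3 = Heath-Brown's density (`x³ + 2y³`), generic window
`ν = 0`: «Heath-Brown's cubic one dimension up».  [IDEA-NEEDED; `FordMaynardMinimalTypeII` zone BY NAME.] -/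
theorem quaternarySexticSlice_of_lowerNonlinear (hL : LowerNonlinear) :
    ∀ f : ℤ[X], IsBatemanHornSystem ![f] → f.Monic → f.natDegree = 6 → (slicePrimes f 4).Infinite :=
  fun f hf hmo hdeg => sliceCells_of_lowerNonlinear hL f hf hmo (by omega) 4 (by norm_num)

/-- **Piece `MaynardBandAllFields`** = the cells `15n ≤ 22m`, `m < n`, for ALL monic Bateman–Horn `f` (Maynard's
Thm 1.2 gives exactly these cells for PURE `f = X^n − θ`; Thm 1.1 gives `4m ≥ 3n` for all `f`).  [ATTACKABLE:
remove purity from the algebraic Type I/II estimates; the density arithmetic is unchanged.] -/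
theorem maynardBandAllFields_of_lowerNonlinear (hL : LowerNonlinear) :
    ∀ n m : ℕ, 15 * n ≤ 22 * m → m < n →
      ∀ f : ℤ[X], IsBatemanHornSystem ![f] → f.Monic → f.natDegree = n → (slicePrimes f m).Infinite := by
  intro n m hnm hmn f hf hmo hdeg
  have hn : 0 < f.natDegree := by simpa using hf.natDegree_pos 0
  exact sliceCells_of_lowerNonlinear hL f hf hmo (by omega) m (by omega)

/-- **Band split (critic row 96 P1), upper sub-band** = the cells `3n ≤ 4m`, `m < n` (`δ ≥ 3/4`): KNOWN THEOREM in
print for ALL monic irreducible `f` (Maynard Thm 1.1, asymptotic; `C^±(P_θ) = 1` for `θ ≤ 1/4`) — RUNGS BY NAME,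
nothing to attack; typed here only as necessary cells.  First cells (4,3), (8,6) (`δ = 3/4` exactly). -/
theorem maynardAsymptoticBand_of_lowerNonlinear (hL : LowerNonlinear) :
    ∀ n m : ℕ, 3 * n ≤ 4 * m → m < n →
      ∀ f : ℤ[X], IsBatemanHornSystem ![f] → f.Monic → f.natDegree = n → (slicePrimes f m).Infinite := by
  intro n m hnm hmn f hf hmo hdeg
  have hn : 0 < f.natDegree := by simpa using hf.natDegree_pos 0
  exact sliceCells_of_lowerNonlinear hL f hf hmo (by omega) m (by omega)

/-- **Band split (critic row 96 P1), lower sub-band** = the cells `15n ≤ 22m` with `4m < 3n` (`15/22 ≤ δ < 3/4`,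
`1/4 < θ ≤ 7/22`): THEOREM for PURE `f = Xⁿ − θ` only (Maynard Thm 1.2); for general monic `f` an
ATTACKABLE-LITERATURE question («remove purity from the algebraic Type I/II inputs of Thm 1.2»; the sieve side —
Ford–Maynard's `C⁻(P_θ) > 0` for `θ ≤ 7/22` — is field-independent), instrument-grade, zero credit.  First cells
(7,5) (`θ = 2/7`), (10,7), (11,8), (13,9). -/
theorem maynardPureBand_of_lowerNonlinear (hL : LowerNonlinear) :
    ∀ n m : ℕ, 15 * n ≤ 22 * m → 4 * m < 3 * n →
      ∀ f : ℤ[X], IsBatemanHornSystem ![f] → f.Monic → f.natDegree = n → (slicePrimes f m).Infinite := by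
  intro n m hnm hmn f hf hmo hdeg
  have hn : 0 < f.natDegree := by simpa using hf.natDegree_pos 0
  exact sliceCells_of_lowerNonlinear hL f hf hmo (by omega) m (by omega)

/-- **The wall cell `BinarySlice`** (m = 2, every degree `n ≥ 2`: binary forms; δ = 2/n ≤ 1/2 for `n ≥ 4`):
necessary, and for `n ≥ 4` BARRIER-class (`Literature.Barriers.Parity.FordMaynardLowLevel` BY NAME); `n = 2, 3` are
theorems in print (Dirichlet–Weber; Heath-Brown–Moroz 2002). -/
theorem binarySlice_of_lowerNonlinear (hL : LowerNonlinear) :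
    ∀ f : ℤ[X], IsBatemanHornSystem ![f] → f.Monic → 2 ≤ f.natDegree → (slicePrimes f 2).Infinite :=
  fun f hf hmo hdeg => sliceCells_of_lowerNonlinear hL f hf hmo hdeg 2 le_rfl

/-- Padding with zeros: the `m`-slice element with coefficients cut off at `m` is an `m'`-slice element, `m ≤ m'`. -/
theorem sliceElt_pad (f : ℤ[X]) {m m' : ℕ} (h : m ≤ m') (x : ℕ → ℤ) :
    sliceElt f m' (fun i => if i < m then x i else 0) = sliceElt f m x := by
  unfold sliceElt
  rw [← Finset.sum_subset (Finset.range_mono h) ?_]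
  · exact Finset.sum_congr rfl fun i hi => by
      rw [Finset.mem_range] at hi
      simp only [if_pos hi]
  · intro i _ hi
    rw [Finset.mem_range, not_lt] at hi
    simp only [if_neg (not_lt.mpr hi), map_zero, zero_mul]

/-- **Monotonicity ALONG the ladder** for one `f`: a prime value of the `m`-slice is a prime value of every thicker
slice `m' ≥ m` — the grade `δ = m/n` only gets easier upward (and `m = 1`, the affine line, feeds `m = 2` by
`sliceNorm_affinePt`). -/
theorem slicePrimes_mono (f : ℤ[X]) {m m' : ℕ} (h : m ≤ m') : slicePrimes f m ⊆ slicePrimes f m' := by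
  rintro p ⟨hp, x, hx⟩
  exact ⟨hp, fun i => if i < m then x i else 0, by unfold sliceNorm at hx ⊢; rw [sliceElt_pad f h x]; exact hx⟩

/-! ## §6 The dial, typed (pure arithmetic of the grade `δ = m/n`; `θ = 1 − δ`, generic window `ν = 3δ − 2`) -/

/-- **Dial facts** for the cells named in the ladder: (4,2) sits ON the wall `δ = 1/2`; (5,3) has an EMPTY generic
Type-II window (`3δ − 2 < 0`); (6,4) is the window's edge `ν = 0` = Heath-Brown's density `2/3`; (7,5) is
`θ = 2/7`, inside Maynard's lower-bound band `15/22 < δ < 3/4`; (8,6) is the asymptotic edge `δ = 3/4`; (25,17) is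
the first cell strictly between `2/3` and `15/22`; (22,15) is exactly Maynard's threshold `θ = 7/22`. -/
theorem dial_facts :
    (2 : ℚ) / 4 = 1 / 2 ∧ 3 * ((3 : ℚ) / 5) - 2 < 0 ∧ 3 * ((4 : ℚ) / 6) - 2 = 0 ∧
      1 - (5 : ℚ) / 7 = 2 / 7 ∧ (15 : ℚ) / 22 < 5 / 7 ∧ (5 : ℚ) / 7 < 3 / 4 ∧ (6 : ℚ) / 8 = 3 / 4 ∧
      (2 : ℚ) / 3 < 17 / 25 ∧ (17 : ℚ) / 25 < 15 / 22 ∧ 1 - (15 : ℚ) / 22 = 7 / 22 := by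
  norm_num

/-- **Where Bateman–Horn itself sits on the dial:** a single polynomial of degree `n ≥ 2` is the grade `δ = 1/n ≤ 1/2`
— at or below the wall for every `n ≥ 2` (the docstring of `Literature.Barriers.Parity.FordMaynardLowLevel`:
«for the values of one integer polynomial of degree g one has 1 − c = 1/g, so γ < 1/2 and no admissible θ < 1/2 as
soon as g ≥ 2»), and strictly below the binary slice `δ = 2/n` of the same polynomial. -/
theorem batemanHorn_grade_le_half {n : ℕ} (hn : 2 ≤ n) : (1 : ℚ) / n ≤ 1 / 2 ∧ (1 : ℚ) / n < 2 / n := by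
  have hn' : (2 : ℚ) ≤ n := by exact_mod_cast hn
  have hpos : (0 : ℚ) < n := by linarith
  constructor
  · rw [div_le_div_iff₀ hpos two_pos]; linarith
  · exact div_lt_div_of_pos_right (by norm_num) hpos
end

end Summit.Parity.BatemanHorn.Theses.OneSidedDegreeLadder.NormFormSlice
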